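import Summits.QuantumFields.YangMills.Theorems.BalabanUVNodesN15DefectKernelTower
import Literature.MathematicalPhysics.QuantumFieldTheory.King1986.MinimizerBlockDecay
import HarnessLib

/-!
# Route «BalabanUVNodes» (K4 «SpineRates»), node N15 = NE2, THE -a ∕ -b INTERFACE OF THE BACKGROUND LAYER, part 7b: THE MINIMISER DOMINANCE
# WITH ADDITIVE SLACK (dag-ref-B READ #102 A4 PIN «TOWER-DOMINANCE-SLACK») AND THE SLACK-FREE UNIT-TORUS DOMINANCE BY NAME

Cell `pub-ymgap`, seat `pub-ymgap-dag-n15-a` (KNIT-BY-NAME, generation g3; HUMAN RULING D-0062; chair R424 venue; `bears_on: R4∕N15`).  Filed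
`--supports stmt-QuantumFields-19351` (helper).  THEOREMS ONLY; imports BY NAME, nothing in the tree modified: part 7 `BalabanUVNodesN15DefectKernelTower`
(this seat g2: `exists_site_labels`, `exists_unitSite_labels`, part 6's `hasMaj_idef_kingPiece_covFree` through it), seat n18-b's
`King1986.MinimizerTwoSpacingDecay` (`minimiser_kernel_decay_labels`, `sitesPerDir_finerVolume`) and `King1986.MinimizerBlockDecay`
(`minimiser_kernel_decay_blocks` = Theorem 3.3 ∕ Prop. 3.7 (3.64) in King's block-distance currency, NO label hypotheses; `blockOf_over`).

WHY (the referee's pin, READS/n15-p414072.md).  Part 7 discharged part 6's Theorem-3.3 binders under the SLACK-FREE dominance `κ·d(blk_Ω b, blk_η x) ≤ ε·T(x, z)`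
(`z` in the block of `b`).  Demanded for EVERY fine `x` — including the first fine layer of the NEIGHBOURING unit block, at tower distance `1` from the
block — it forces adjacent unit blocks to carrier distance `≤ ε∕κ`, so the typed decay `e^{−δ₀κ·d}` is never better than a decay length of `L^K` unit
blocks: sound, but NOT a K-uniform single-scale piece.  Print absorbs the adjacent-block case into the constant.  THIS FILE repairs it both ways:
* §1 **`minimiser_decay_of_dominance_slack`** — EXACTLY the referee's repair: dominance WITH ADDITIVE SLACK `κ·d ≤ ε·T + C` (`C ≥ 0`), proof with
  `D := max 0 ((κd − C)∕ε)` in `minimiser_kernel_decay_labels` and `e^{−δ₀εD} ≤ e^{δ₀C}e^{−δ₀κd}`; conclusion `a·(c₀e^{δ₀C})·e^{−δ₀κ·d}` for both runs,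
  K-UNIFORM (with `C = κ = 1` the centre-distance unit carrier with `blk_η = B` meets it: `ε·T(x, z) ≥ |b − b′|_∞ − 1`);
  **`minimiser_decay_of_blockDominance`** — the tower-label dominance DISCHARGED by n18-b's dictionary: only the slack-free UNIT-TORUS dominance
  `κ·d(blk_Ω b, blk_η x) ≤ |b − B(x)|_{T₁}` (`tdistT`; met with `κ = 1` and EQUALITY by that carrier) — conclusion `a·c₀·e^{−δ₀κ·d}`, uncapped.
* §2 **`hasMaj_idef_kingPiece_tower_slack`** (part 7 §3 with `c₀ ↦ c₀e^{δ₀C}`) and **`hasMaj_idef_kingPiece_blocks`** (part 7 §3 with the two tower-label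
  dominances REPLACED by the one unit-torus dominance): King's (4.42) single-scale piece on Bałaban's volumes, every analytic input by name, rate window
  `ρ + σ_r ≤ δ₀κ∕2`, `ρ + σ_r ≤ δ_C` with `δ₀` a function of `d, L, a, m²` only — K-UNIFORM.

HONEST FRAMING ∕ LIMITS.  King's scalar `A = 0` MODEL (template literature) of binder (a) for ONE single-scale piece; a change of binders of PROVED tree
theorems, no new estimate; the geometric binders (carrier, site assignments, King's pairing, the unit-torus dominances, the window) are the consumer's;
NOT Bałaban's covariant objects; NE2⁺ NOT PRINTED ∕ not proved; count-neutral (typed 28∕28 · discharged unchanged); NOT a discharge of N15; one finite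
T⁴ at fixed ε — NOT infinite volume, NOT OS on ℝ⁴, NOT a mass gap, NOT Clay.
-/

noncomputable section

namespace Summit.QuantumFields.YangMills.BalabanUVNodes.N15.DefectKernel

open Literature.MathematicalPhysics.QuantumFieldTheory.Balaban1983to89
open Literature.MathematicalPhysics.QuantumFieldTheory.Balaban1983to89.B11SectG (BlockNorm HasMaj RowSum)
open Literature.MathematicalPhysics.QuantumFieldTheory.Balaban1983to89.T4EtaRateDefect (idef)
open Literature.MathematicalPhysics.QuantumFieldTheory.Balaban1983to89.T4EtaRateCoeffDefect (pull fibre)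
open Literature.MathematicalPhysics.QuantumFieldTheory.Balaban1983to89.B6RandomWalk (Triangle254)
open Literature.MathematicalPhysics.QuantumFieldTheory.Balaban1983to89.B5Prop11Plancherel (Tor fine)
open Literature.MathematicalPhysics.QuantumFieldTheory.King1986 (aK aK_le prop38RateConst prop38PosConst lemma43Const)
open Literature.MathematicalPhysics.QuantumFieldTheory.King1986.Torus (minimiser effLaplacian blockProj tdistT K45 delta45 gam0L
  minimiser_kernel_decay_labels sitesPerDir_finerVolume)

/-! ## §1 The minimiser dominance WITH ADDITIVE SLACK, and the slack-free UNIT-TORUS dominance through n18-b's dictionary -/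

section Slack

open Literature.MathematicalPhysics.QuantumFieldTheory.Balaban1983to89.B5Ineq137Torus (T T_nonneg)
open Literature.MathematicalPhysics.QuantumFieldTheory.King1986.Torus (blockOf minimiser_kernel_decay_blocks blockOf_over
  tdistT_symm)

/-- **THEOREM 3.3 FOR KING'S MINIMISER IN THE CARRIER'S DISTANCE — DOMINANCE WITH ADDITIVE SLACK** (dag-ref-B READ #102 A4 PIN,
the REPAIR as written).  There are `δ₀, c₀ > 0` (functions of `d, L, a, m²`) such that for every volume `P = (d, L, m, K)` with `K ≥ 1`,
every `n`, the unit torus `M_μ = 2L^m`, any [B6] carrier with site assignments `blkΩ`, `blkη`, any map `pr`, any `κ > 0` and SLACK `C ≥ 0`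
with `κ·d(blkΩ bt, blkη xt) ≤ ε·T(x, z) + C` for all tower twins `x` of `xt` and all `z` in the block of the twin of `bt` (and likewise
at the finer volume for `blkη (pr xt′)`), King's ACTUAL minimiser kernels satisfy `|ℋ_K(δ_bt)(xt)| ≤ a·(c₀e^{δ₀C})·e^{−δ₀κ·d(blkΩ bt, blkη xt)}`
and `|ℋ_{K+n}(δ_bt)(xt′)| ≤ a·(c₀e^{δ₀C})·e^{−δ₀κ·d(blkΩ bt, blkη(pr xt′))}` — part 6's binders `hdecH`, `hdecH′` with `c₀ ↦ a·c₀e^{δ₀C}`,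
`δ₀ ↦ δ₀κ`, K-UNIFORM (proof: `D := max 0 ((κd − C)∕ε)` in `minimiser_kernel_decay_labels`, `e^{−δ₀εD} ≤ e^{δ₀C}e^{−δ₀κd}`).  With `C = 1`,
`κ = 1`, the centre-distance unit carrier and `blkη` = block projection the slack dominance holds (`ε·T(x, z) ≥ |b − b′|_∞ − 1`).
[cite: King1986, Theorem 3.3 p.658, Prop. 3.7 (3.64) p.663; Balaban1983RegularityDecay, Theorem (1.10) p.573] -/
theorem minimiser_decay_of_dominance_slack (dd L : ℕ) (hd : 1 ≤ dd) (hL : Odd L ∧ 1 < L) {a m2 : ℝ} (ha : 0 < a)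
    (hm : 0 < m2) :
    ∃ δ₀ c₀ : ℝ, 0 < δ₀ ∧ 0 < c₀ ∧ ∀ (P : Params) (_ : P.d = dd) (_ : P.L = L) (_ : 1 ≤ P.K) [NeZero P.L] (n : ℕ)
      (M : Fin P.d → ℕ) [∀ μ, NeZero (M μ)] (hMK : ∀ μ, M μ = P.sitesPerDir P.K)
      {g : B6.Geometry} (blkΩ : Tor M → g.Site) (blkη : Tor (fine (P.L ^ P.K) M) → g.Site)
      (pr : Tor (fine (P.L ^ n * P.L ^ P.K) M) → Tor (fine (P.L ^ P.K) M)) (hdist : ∀ y y' : g.Site, 0 ≤ g.dist y y')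
      {κ C : ℝ} (_ : 0 < κ) (_ : 0 ≤ C)
      (_ : ∀ (bt : Tor M) (xt : Tor (fine (P.L ^ P.K) M)) (x z : Site P 0) (b : Site P P.K),
        (∀ μ, (xt μ).val = (x μ).val) → (∀ μ, (bt μ).val = (b μ).val) → Site.proj P.K P.K z = b →
        κ * g.dist (blkΩ bt) (blkη xt) ≤ P.eps * T P 0 x z + C)
      (_ : ∀ (bt : Tor M) (xt' : Tor (fine (P.L ^ n * P.L ^ P.K) M))
        (x' z' : Site (⟨P.d, P.L, P.m, P.K + n, P.hd, P.hL⟩ : Params) 0)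
        (b' : Site (⟨P.d, P.L, P.m, P.K + n, P.hd, P.hL⟩ : Params) (P.K + n)),
        (∀ μ, (xt' μ).val = (x' μ).val) → (∀ μ, (bt μ).val = (b' μ).val) → Site.proj (P.K + n) (P.K + n) z' = b' →
        κ * g.dist (blkΩ bt) (blkη (pr xt')) ≤
          (⟨P.d, P.L, P.m, P.K + n, P.hd, P.hL⟩ : Params).eps * T (⟨P.d, P.L, P.m, P.K + n, P.hd, P.hL⟩ : Params) 0 x' z'
            + C),
      (∀ (bt : Tor M) (xt : Tor (fine (P.L ^ P.K) M)),
        |minimiser (P.L ^ P.K) M (aK a P.L P.K) (((P.L ^ P.K : ℕ) : ℝ) ^ 2) m2 (Pi.single bt 1) xt|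
          ≤ a * (c₀ * Real.exp (δ₀ * C)) * Real.exp (-(δ₀ * κ * g.dist (blkΩ bt) (blkη xt)))) ∧
      (1 ≤ n → ∀ (bt : Tor M) (xt' : Tor (fine (P.L ^ n * P.L ^ P.K) M)),
        |minimiser (P.L ^ n * P.L ^ P.K) M (aK a P.L (P.K + n)) (((P.L ^ n * P.L ^ P.K : ℕ) : ℝ) ^ 2) m2
            (Pi.single bt 1) xt'|
          ≤ a * (c₀ * Real.exp (δ₀ * C)) * Real.exp (-(δ₀ * κ * g.dist (blkΩ bt) (blkη (pr xt'))))) := by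
  obtain ⟨δ₀, c₀, hδ₀, hc₀, H⟩ := minimiser_kernel_decay_labels dd L hd hL ha hm.le
  refine ⟨δ₀, c₀, hδ₀, hc₀, ?_⟩
  intro P hPd hPL hK _ n M _ hMK g blkΩ blkη pr hdist κ C hκ hC hdomA hdomB
  have hLr : (1 : ℝ) < P.L := by exact_mod_cast P.hL.2
  -- the slack step: `dκ − C ≤ εD` turns `e^{−δ₀εD}` into `e^{δ₀C}·e^{−δ₀dκ}`
  have hexp : ∀ {ε D dκ : ℝ}, dκ - C ≤ ε * D →
      Real.exp (-(δ₀ * (ε * D))) ≤ Real.exp (δ₀ * C) * Real.exp (-(δ₀ * dκ)) := by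
    intro ε D dκ h
    rw [← Real.exp_add]
    exact Real.exp_le_exp.mpr (by nlinarith [mul_le_mul_of_nonneg_left h hδ₀.le])
  constructor
  · -- run A: the volume `P`
    intro bt xt
    have hεA : 0 < P.eps := Params.eps_pos P
    obtain ⟨x, hx⟩ := exists_site_labels P M hMK (P.L ^ P.K) rfl xt
    obtain ⟨b, hb⟩ := exists_unitSite_labels P M hMK bt
    set D : ℝ := max 0 ((κ * g.dist (blkΩ bt) (blkη xt) - C) / P.eps) with hD
    have hD0 : 0 ≤ D := le_max_left _ _
    have hDle : ∀ z : Site P 0, Site.proj P.K P.K z = b → D ≤ T P 0 x z := fun z hz => by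
      rcases le_total ((κ * g.dist (blkΩ bt) (blkη xt) - C) / P.eps) 0 with h | h
      · rw [hD, max_eq_left h]; exact T_nonneg P 0 x z
      · rw [hD, max_eq_right h, div_le_iff₀ hεA]
        have := hdomA bt xt x z b hx hb hz
        linarith [mul_comm P.eps (T P 0 x z)]
    have hεD : κ * g.dist (blkΩ bt) (blkη xt) - C ≤ P.eps * D := by
      have h1 : P.eps * ((κ * g.dist (blkΩ bt) (blkη xt) - C) / P.eps) ≤ P.eps * D :=
        mul_le_mul_of_nonneg_left (le_max_right _ _) hεA.le
      rwa [mul_div_cancel₀ _ hεA.ne'] at h1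
    have hA := H P hPd hPL hK M hMK (P.L ^ P.K) rfl xt x hx bt b hb D hD0 hDle
    calc |minimiser (P.L ^ P.K) M (aK a P.L P.K) (((P.L ^ P.K : ℕ) : ℝ) ^ 2) m2 (Pi.single bt 1) xt|
        ≤ aK a P.L P.K * c₀ * Real.exp (-(δ₀ * (P.eps * D))) := hA
      _ ≤ a * c₀ * (Real.exp (δ₀ * C) * Real.exp (-(δ₀ * (κ * g.dist (blkΩ bt) (blkη xt))))) :=
          mul_le_mul (mul_le_mul_of_nonneg_right (aK_le ha hLr hK) hc₀.le) (hexp hεD) (Real.exp_pos _).le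
            (mul_nonneg ha.le hc₀.le)
      _ = a * (c₀ * Real.exp (δ₀ * C)) * Real.exp (-(δ₀ * κ * g.dist (blkΩ bt) (blkη xt))) := by ring_nf
  · -- run B: the finer volume `(d, L, m, K + n)` over the same unit torus
    intro hn bt xt'
    have hεB : 0 < ((⟨P.d, P.L, P.m, P.K + n, P.hd, P.hL⟩ : Params)).eps := Params.eps_pos _
    have hMK' : ∀ μ, M μ = (⟨P.d, P.L, P.m, P.K + n, P.hd, P.hL⟩ : Params).sitesPerDir (P.K + n) := fun μ => by
      rw [hMK μ]; exact (sitesPerDir_finerVolume P n).symm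
    have hN : P.L ^ n * P.L ^ P.K = P.L ^ (P.K + n) := by rw [pow_add, mul_comm]
    obtain ⟨x', hx'⟩ := exists_site_labels (⟨P.d, P.L, P.m, P.K + n, P.hd, P.hL⟩ : Params) M hMK'
      (P.L ^ n * P.L ^ P.K) hN xt'
    obtain ⟨b', hb'⟩ := exists_unitSite_labels (⟨P.d, P.L, P.m, P.K + n, P.hd, P.hL⟩ : Params) M hMK' bt
    set D : ℝ := max 0 ((κ * g.dist (blkΩ bt) (blkη (pr xt')) - C) /
      ((⟨P.d, P.L, P.m, P.K + n, P.hd, P.hL⟩ : Params)).eps) with hD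
    have hD0 : 0 ≤ D := le_max_left _ _
    have hDle : ∀ z' : Site (⟨P.d, P.L, P.m, P.K + n, P.hd, P.hL⟩ : Params) 0,
        Site.proj (P.K + n) (P.K + n) z' = b' →
        D ≤ T (⟨P.d, P.L, P.m, P.K + n, P.hd, P.hL⟩ : Params) 0 x' z' := fun z' hz' => by
      rcases le_total ((κ * g.dist (blkΩ bt) (blkη (pr xt')) - C) /
        ((⟨P.d, P.L, P.m, P.K + n, P.hd, P.hL⟩ : Params)).eps) 0 with h | h
      · rw [hD, max_eq_left h]; exact T_nonneg _ 0 x' z'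
      · rw [hD, max_eq_right h, div_le_iff₀ hεB]
        have := hdomB bt xt' x' z' b' hx' hb' hz'
        linarith [mul_comm ((⟨P.d, P.L, P.m, P.K + n, P.hd, P.hL⟩ : Params)).eps
          (T (⟨P.d, P.L, P.m, P.K + n, P.hd, P.hL⟩ : Params) 0 x' z')]
    have hεD : κ * g.dist (blkΩ bt) (blkη (pr xt')) - C ≤
        ((⟨P.d, P.L, P.m, P.K + n, P.hd, P.hL⟩ : Params)).eps * D := by
      have h1 : ((⟨P.d, P.L, P.m, P.K + n, P.hd, P.hL⟩ : Params)).eps *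
            ((κ * g.dist (blkΩ bt) (blkη (pr xt')) - C) / ((⟨P.d, P.L, P.m, P.K + n, P.hd, P.hL⟩ : Params)).eps)
          ≤ ((⟨P.d, P.L, P.m, P.K + n, P.hd, P.hL⟩ : Params)).eps * D :=
        mul_le_mul_of_nonneg_left (le_max_right _ _) hεB.le
      rwa [mul_div_cancel₀ _ hεB.ne'] at h1
    have hB := H (⟨P.d, P.L, P.m, P.K + n, P.hd, P.hL⟩ : Params) hPd hPL (show 1 ≤ P.K + n by omega) M hMK'
      (P.L ^ n * P.L ^ P.K) hN xt' x' hx' bt b' hb' D hD0 hDle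
    calc |minimiser (P.L ^ n * P.L ^ P.K) M (aK a P.L (P.K + n)) (((P.L ^ n * P.L ^ P.K : ℕ) : ℝ) ^ 2) m2
            (Pi.single bt 1) xt'|
        ≤ aK a P.L (P.K + n) * c₀ *
            Real.exp (-(δ₀ * (((⟨P.d, P.L, P.m, P.K + n, P.hd, P.hL⟩ : Params)).eps * D))) := hB
      _ ≤ a * c₀ * (Real.exp (δ₀ * C) * Real.exp (-(δ₀ * (κ * g.dist (blkΩ bt) (blkη (pr xt')))))) :=
          mul_le_mul (mul_le_mul_of_nonneg_right (aK_le ha hLr (show 1 ≤ P.K + n by omega)) hc₀.le) (hexp hεD)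
            (Real.exp_pos _).le (mul_nonneg ha.le hc₀.le)
      _ = a * (c₀ * Real.exp (δ₀ * C)) * Real.exp (-(δ₀ * κ * g.dist (blkΩ bt) (blkη (pr xt')))) := by ring_nf

/-- **THEOREM 3.3 FOR KING'S MINIMISER IN THE CARRIER'S DISTANCE — FROM THE SLACK-FREE UNIT-TORUS DOMINANCE, BY NAME.**  Seat
n18-b's `King1986.MinimizerBlockDecay.minimiser_kernel_decay_blocks` states Theorem 3.3 ∕ Prop. 3.7 (3.64) in King's own currency,
`|ℋ_K(x, b)| ≤ a_K·c₀·e^{−δ₀·|B(x) − b|_{T₁}}` with NO label hypotheses (`δ₀, c₀` from `d, L, a, m²`; the slack already inside `c₀`).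
Hence: for every volume `P = (d, L, m, K)` (`K ≥ 1`), every `n`, the unit torus `M_μ = 2L^m`, any [B6] carrier, site assignments
`blkΩ`, `blkη`, King's pairing `pr` (labels `⌊·∕L^n⌋`, so both runs see the same unit block, `blockOf_over`) and any `κ > 0` with the
slack-free UNIT-TORUS dominance `κ·d(blkΩ bt, blkη xt) ≤ |bt − B(xt)|_{T₁}` (`tdistT`; met with `κ = 1` and EQUALITY by the
centre-distance unit carrier with `blkη = B`): `|ℋ_K(δ_bt)(xt)| ≤ a·c₀·e^{−δ₀κ·d(blkΩ bt, blkη xt)}` and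
`|ℋ_{K+n}(δ_bt)(xt′)| ≤ a·c₀·e^{−δ₀κ·d(blkΩ bt, blkη(pr xt′))}` — part 6's `hdecH`∕`hdecH′` with `c₀ ↦ a·c₀`, `δ₀ ↦ δ₀κ`, K-UNIFORM and
UNCAPPED. [cite: King1986, Theorem 3.3 p.658, Prop. 3.7 (3.64) p.663; Balaban1983RegularityDecay, Theorem (1.10) p.573] -/
theorem minimiser_decay_of_blockDominance (dd L : ℕ) (hd : 1 ≤ dd) (hL : Odd L ∧ 1 < L) {a m2 : ℝ} (ha : 0 < a)
    (hm : 0 < m2) :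
    ∃ δ₀ c₀ : ℝ, 0 < δ₀ ∧ 0 < c₀ ∧ ∀ (P : Params) (_ : P.d = dd) (_ : P.L = L) (_ : 1 ≤ P.K) [NeZero P.L] (n : ℕ)
      (M : Fin P.d → ℕ) [∀ μ, NeZero (M μ)] (_ : ∀ μ, M μ = P.sitesPerDir P.K)
      {g : B6.Geometry} (blkΩ : Tor M → g.Site) (blkη : Tor (fine (P.L ^ P.K) M) → g.Site)
      (pr : Tor (fine (P.L ^ n * P.L ^ P.K) M) → Tor (fine (P.L ^ P.K) M))
      (_ : ∀ x' μ, (pr x' μ).val = (x' μ).val / P.L ^ n) (_ : ∀ y y' : g.Site, 0 ≤ g.dist y y')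
      {κ : ℝ} (_ : 0 < κ)
      (_ : ∀ (bt : Tor M) (xt : Tor (fine (P.L ^ P.K) M)),
        κ * g.dist (blkΩ bt) (blkη xt) ≤ tdistT M bt (blockOf (P.L ^ P.K) M xt)),
      (∀ (bt : Tor M) (xt : Tor (fine (P.L ^ P.K) M)),
        |minimiser (P.L ^ P.K) M (aK a P.L P.K) (((P.L ^ P.K : ℕ) : ℝ) ^ 2) m2 (Pi.single bt 1) xt|
          ≤ a * c₀ * Real.exp (-(δ₀ * κ * g.dist (blkΩ bt) (blkη xt)))) ∧
      (1 ≤ n → ∀ (bt : Tor M) (xt' : Tor (fine (P.L ^ n * P.L ^ P.K) M)),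
        |minimiser (P.L ^ n * P.L ^ P.K) M (aK a P.L (P.K + n)) (((P.L ^ n * P.L ^ P.K : ℕ) : ℝ) ^ 2) m2
            (Pi.single bt 1) xt'|
          ≤ a * c₀ * Real.exp (-(δ₀ * κ * g.dist (blkΩ bt) (blkη (pr xt'))))) := by
  obtain ⟨δ₀, c₀, hδ₀, hc₀, H⟩ := minimiser_kernel_decay_blocks dd L hd hL ha hm.le
  refine ⟨δ₀, c₀, hδ₀, hc₀, ?_⟩
  intro P hPd hPL hK _ n M _ hMK g blkΩ blkη pr hpr hdist κ hκ hdomU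
  have hLr : (1 : ℝ) < P.L := by exact_mod_cast P.hL.2
  -- the dominance step: `κ·d ≤ |bt − B(xt)|` turns `e^{−δ₀|B(xt) − bt|}` into `e^{−δ₀κ·d}`
  have step : ∀ {A : ℝ} (_ : 0 ≤ A) (bt : Tor M) (xt : Tor (fine (P.L ^ P.K) M)),
      A * Real.exp (-(δ₀ * tdistT M (blockOf (P.L ^ P.K) M xt) bt))
        ≤ A * Real.exp (-(δ₀ * κ * g.dist (blkΩ bt) (blkη xt))) := by
    intro A hA bt xt
    refine mul_le_mul_of_nonneg_left (Real.exp_le_exp.mpr ?_) hA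
    rw [tdistT_symm]
    have h := mul_le_mul_of_nonneg_left (hdomU bt xt) hδ₀.le
    linarith [mul_assoc δ₀ κ (g.dist (blkΩ bt) (blkη xt))]
  constructor
  · -- run A: the volume `P`
    intro bt xt
    have hA := H P hPd hPL hK M hMK (P.L ^ P.K) rfl xt bt
    exact (hA.trans (mul_le_mul_of_nonneg_right (mul_le_mul_of_nonneg_right (aK_le ha hLr hK) hc₀.le)
      (Real.exp_pos _).le)).trans (step (mul_nonneg ha.le hc₀.le) bt xt)
  · -- run B: the finer volume `(d, L, m, K + n)` over the same unit torus; both runs see the same unit block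
    intro hn bt xt'
    have hMK' : ∀ μ, M μ = (⟨P.d, P.L, P.m, P.K + n, P.hd, P.hL⟩ : Params).sitesPerDir (P.K + n) := fun μ => by
      rw [hMK μ]; exact (sitesPerDir_finerVolume P n).symm
    have hN : P.L ^ n * P.L ^ P.K = P.L ^ (P.K + n) := by rw [pow_add, mul_comm]
    have hB := H (⟨P.d, P.L, P.m, P.K + n, P.hd, P.hL⟩ : Params) hPd hPL (show 1 ≤ P.K + n by omega) M hMK'
      (P.L ^ n * P.L ^ P.K) hN xt' bt
    rw [blockOf_over M (pr xt') xt' (hpr xt')] at hB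
    exact (hB.trans (mul_le_mul_of_nonneg_right (mul_le_mul_of_nonneg_right
      (aK_le ha hLr (show 1 ≤ P.K + n by omega)) hc₀.le) (Real.exp_pos _).le)).trans
      (step (mul_nonneg ha.le hc₀.le) bt (pr xt'))

end Slack

/-! ## §2 The single-scale piece with the repaired dominances -/

section PieceSlack

open Literature.MathematicalPhysics.QuantumFieldTheory.Balaban1983to89.B5Ineq137Torus (T)
open Literature.MathematicalPhysics.QuantumFieldTheory.King1986.Torus (blockOf)

/-- **KING'S SINGLE-SCALE PIECE (4.42) ON BAŁABAN'S VOLUMES — MINIMISER DOMINANCE WITH ADDITIVE SLACK** (dag-ref-B READ #102: §3 with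
`c₀ ↦ c₀e^{δ₀C}`).  As `hasMaj_idef_kingPiece_tower`, but the minimiser dominance carries the slack `C ≥ 0`:
`κ·d(blkΩ bt, blkη xt) ≤ ε·T(x, z) + C` (both volumes); the block majorant is part 6's with `c₀ ↦ a·c₀e^{δ₀C}`, `δ₀ ↦ δ₀κ`, the rate
window `ρ + σ_r ≤ δ₀κ∕2`, `ρ + σ_r ≤ δ_C` — K-UNIFORM (`δ₀, c₀` from `d, L, a, m²`).
[cite: King1986, (4.42)–(4.43) p.675; Prop. 3.8 (3.71) p.664; Lemma 4.5 (4.38), (4.33)–(4.34) p.674, Theorem 3.3 p.658; Balaban1983RegularityDecay, (1.10) p.573] -/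
theorem hasMaj_idef_kingPiece_tower_slack (dd L : ℕ) (hd : 1 ≤ dd) (hL : Odd L ∧ 1 < L) {a m2 : ℝ} (ha : 0 < a)
    (hm : 0 < m2) {γ : ℝ} (hγ0 : 0 ≤ γ) (hγ1 : γ ≤ 1) :
    ∃ δ₀ c₀ : ℝ, 0 < δ₀ ∧ 0 < c₀ ∧ ∀ (P : Params) (_ : P.d = dd) (_ : P.L = L) (_ : 1 ≤ P.K) [NeZero P.L]
      (n : ℕ) (_ : 1 ≤ n) (M : Fin P.d → ℕ) [∀ μ, NeZero (M μ)] (_ : ∀ μ, fine P.L M μ = P.sitesPerDir P.K)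
      -- the carrier and the site assignments
      {g : B6.Geometry} [DecidableEq g.Site] (_ : Triangle254 g) (_ : ∀ y y' : g.Site, 0 ≤ g.dist y y')
      (_ : ∀ y y' : g.Site, g.dist y y' = g.dist y' y) {σr cr : ℝ} (_ : 0 ≤ σr) (_ : RowSum g σr cr)
      (blkΩ : Tor (fine P.L M) → g.Site) {nΩ : ℕ} (_ : ∀ y', (fibre blkΩ y').card ≤ nΩ)
      (blkη : Tor (fine (P.L ^ P.K) (fine P.L M)) → g.Site) {nη : ℕ} (_ : ∀ y', (fibre blkη y').card ≤ nη)
      (pr : Tor (fine (P.L ^ n * P.L ^ P.K) (fine P.L M)) → Tor (fine (P.L ^ P.K) (fine P.L M)))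
      (_ : ∀ x' μ, (pr x' μ).val = (x' μ).val / P.L ^ n)
      -- King's actual operators, read off as linear maps
      (H : (Tor (fine P.L M) → ℝ) →ₗ[ℝ] (Tor (fine (P.L ^ P.K) (fine P.L M)) → ℝ))
      (_ : ∀ φ, H φ = minimiser (P.L ^ P.K) (fine P.L M) (aK a P.L P.K) (((P.L ^ P.K : ℕ) : ℝ) ^ 2) m2 φ)
      (H' : (Tor (fine P.L M) → ℝ) →ₗ[ℝ] (Tor (fine (P.L ^ n * P.L ^ P.K) (fine P.L M)) → ℝ))
      (_ : ∀ φ, H' φ = minimiser (P.L ^ n * P.L ^ P.K) (fine P.L M) (aK a P.L (P.K + n))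
        (((P.L ^ n * P.L ^ P.K : ℕ) : ℝ) ^ 2) m2 φ)
      {w : ℝ} (_ : 0 ≤ w) (K : (Tor (fine (P.L ^ P.K) (fine P.L M)) → ℝ) →ₗ[ℝ] (Tor (fine P.L M) → ℝ))
      (_ : ∀ x b, K (Pi.single x 1) b = w * H (Pi.single b 1) x)
      (K' : (Tor (fine (P.L ^ n * P.L ^ P.K) (fine P.L M)) → ℝ) →ₗ[ℝ] (Tor (fine P.L M) → ℝ))
      (_ : ∀ x' b, K' (Pi.single x' 1) b = w / ((P.L : ℝ) ^ n) ^ P.d * H' (Pi.single b 1) x')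
      -- the C-dominance (slack-free, point-to-point on the unit torus) and the minimiser dominance WITH SLACK `C`
      {δC : ℝ} (_ : ∀ x z, δC * g.dist (blkΩ x) (blkΩ z) ≤ delta45 P.d a P.L * tdistT (fine P.L M) x z)
      {κ C : ℝ} (_ : 0 < κ) (_ : 0 ≤ C)
      (_ : ∀ (bt : Tor (fine P.L M)) (xt : Tor (fine (P.L ^ P.K) (fine P.L M))) (x z : Site P 0) (b : Site P P.K),
        (∀ μ, (xt μ).val = (x μ).val) → (∀ μ, (bt μ).val = (b μ).val) → Site.proj P.K P.K z = b →
        κ * g.dist (blkΩ bt) (blkη xt) ≤ P.eps * T P 0 x z + C)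
      (_ : ∀ (bt : Tor (fine P.L M)) (xt' : Tor (fine (P.L ^ n * P.L ^ P.K) (fine P.L M)))
        (x' z' : Site (⟨P.d, P.L, P.m, P.K + n, P.hd, P.hL⟩ : Params) 0)
        (b' : Site (⟨P.d, P.L, P.m, P.K + n, P.hd, P.hL⟩ : Params) (P.K + n)),
        (∀ μ, (xt' μ).val = (x' μ).val) → (∀ μ, (bt μ).val = (b' μ).val) → Site.proj (P.K + n) (P.K + n) z' = b' →
        κ * g.dist (blkΩ bt) (blkη (pr xt')) ≤
          (⟨P.d, P.L, P.m, P.K + n, P.hd, P.hL⟩ : Params).eps * T (⟨P.d, P.L, P.m, P.K + n, P.hd, P.hL⟩ : Params) 0 x' z'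
            + C)
      -- the rate window
      {ρ : ℝ} (_ : 0 ≤ ρ) (_ : ρ + σr ≤ δ₀ * κ / 2) (_ : ρ + σr ≤ δC),
      HasMaj (BlockNorm.ofBlocks g blkη) (BlockNorm.ofBlocks g (blkη ∘ pr))
        (idef (pull pr) (pull pr)
          (H' ∘ₗ (Matrix.mulVecLin (effLaplacian (P.L ^ n * P.L ^ P.K) (fine P.L M) (aK a P.L (P.K + n))
              (((P.L ^ n * P.L ^ P.K : ℕ) : ℝ) ^ 2) m2 + (a * ((P.L : ℝ) ^ 2)⁻¹) • blockProj P.L M)⁻¹ ∘ₗ K'))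
          (H ∘ₗ (Matrix.mulVecLin (effLaplacian (P.L ^ P.K) (fine P.L M) (aK a P.L P.K) (((P.L ^ P.K : ℕ) : ℝ) ^ 2) m2
              + (a * ((P.L : ℝ) ^ 2)⁻¹) • blockProj P.L M)⁻¹ ∘ₗ K)))
        (fun y y' =>
          (nΩ * (a * (c₀ * Real.exp (δ₀ * C))) * cr *
              (nΩ * (2 / gam0L P.d a P.L) * cr *
                  (nη * w * Real.sqrt ((prop38RateConst a a (lemma43Const a P.L P.K n) ((Real.pi ^ 2 / 4) ^ P.d) P.d γ
                    + prop38PosConst a ((Real.pi ^ 2 / 4) ^ P.d) P.d γ) * ((P.L ^ P.K : ℕ) : ℝ) ^ (-γ) *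
                      (2 * (a * (c₀ * Real.exp (δ₀ * C))))))
                + nΩ * (K45 P.d a P.L * ((P.L : ℝ) ^ P.K)⁻¹) * cr * (nη * w * (a * (c₀ * Real.exp (δ₀ * C)))))
            + nΩ * Real.sqrt ((prop38RateConst a a (lemma43Const a P.L P.K n) ((Real.pi ^ 2 / 4) ^ P.d) P.d γ
                  + prop38PosConst a ((Real.pi ^ 2 / 4) ^ P.d) P.d γ) * ((P.L ^ P.K : ℕ) : ℝ) ^ (-γ) *
                    (2 * (a * (c₀ * Real.exp (δ₀ * C))))) * cr *
              (nΩ * (2 / gam0L P.d a P.L) * cr * (nη * w * (a * (c₀ * Real.exp (δ₀ * C)))))) *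
          Real.exp (-(ρ * g.dist y y'))) := by
  obtain ⟨δ₀, c₀, hδ₀, hc₀, H⟩ := minimiser_decay_of_dominance_slack dd L hd hL ha hm
  refine ⟨δ₀, c₀, hδ₀, hc₀, ?_⟩
  intro P hPd hPL hPK _ n hn M _ hMK g _ htri hdist hsymm σr cr hσr hrow blkΩ nΩ hnΩ blkη nη hnη pr hpr Hk hH Hk' hH'
    w hw0 K hK K' hK' δC hdom κ C hκ hC hdomA hdomB ρ hρ hρ₁ hρ₂
  have hPd0 : 0 < P.d := by have := P.hd; omega
  have hPodd : Odd P.L := P.hL.1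
  have hPL2 : 2 ≤ P.L := by have := P.hL.2; omega
  obtain ⟨hdecA, hdecB⟩ := H P hPd hPL hPK n (fine P.L M) hMK blkΩ blkη pr hdist hκ hC hdomA hdomB
  exact hasMaj_idef_kingPiece_covFree hPd0 hPodd hPL2 hPK hn M ha hm hγ0 hγ1 htri hdist hsymm hσr hrow blkΩ hnΩ
    blkη hnη pr hpr Hk hH Hk' hH' hw0 K hK K' hK' (c₀ := a * (c₀ * Real.exp (δ₀ * C))) (δ₀ := δ₀ * κ)
    (mul_nonneg ha.le (mul_nonneg hc₀.le (Real.exp_pos _).le))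
    (fun b x => by rw [hH]; exact hdecA b x) (fun b x' => by rw [hH']; exact hdecB hn b x') hρ hdom hρ₁ hρ₂

/-- **KING'S SINGLE-SCALE PIECE (4.42) ON BAŁABAN'S VOLUMES — THEOREM 3.3 IN KING'S OWN CURRENCY BY NAME (n18-b's `MinimizerBlockDecay`),
ONLY THE SLACK-FREE UNIT-TORUS DOMINANCE LEFT.**  As `hasMaj_idef_kingPiece_tower`, but the two tower-label dominances are REPLACED by
the one unit-torus dominance `κ·d(blkΩ bt, blkη xt) ≤ |bt − B(xt)|_{T₁}` (`tdistT` on the unit torus `Tor (fine L M)`, `B = blockOf`;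
met with `κ = 1` and equality by the centre-distance unit carrier with `blkη = B`); the block majorant is part 6's with `c₀ ↦ a·c₀`,
`δ₀ ↦ δ₀κ`, the rate window `ρ + σ_r ≤ δ₀κ∕2`, `ρ + σ_r ≤ δ_C` — K-UNIFORM and UNCAPPED (`δ₀, c₀` from `d, L, a, m²`; every analytic
input by name: Prop. 3.8 (3.71) and Theorem 3.3 in block currency (n18-b), Lemma 4.5 ∕ (4.33)–(4.34) (template lineage)).
[cite: King1986, (4.42)–(4.43) p.675; Prop. 3.8 (3.71) p.664; Prop. 3.7 (3.64) p.663; Lemma 4.5 (4.38), (4.33)–(4.34) p.674, Theorem 3.3 p.658; Balaban1983RegularityDecay, (1.10) p.573] -/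
theorem hasMaj_idef_kingPiece_blocks (dd L : ℕ) (hd : 1 ≤ dd) (hL : Odd L ∧ 1 < L) {a m2 : ℝ} (ha : 0 < a) (hm : 0 < m2)
    {γ : ℝ} (hγ0 : 0 ≤ γ) (hγ1 : γ ≤ 1) :
    ∃ δ₀ c₀ : ℝ, 0 < δ₀ ∧ 0 < c₀ ∧ ∀ (P : Params) (_ : P.d = dd) (_ : P.L = L) (_ : 1 ≤ P.K) [NeZero P.L]
      (n : ℕ) (_ : 1 ≤ n) (M : Fin P.d → ℕ) [∀ μ, NeZero (M μ)] (_ : ∀ μ, fine P.L M μ = P.sitesPerDir P.K)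
      -- the carrier and the site assignments
      {g : B6.Geometry} [DecidableEq g.Site] (_ : Triangle254 g) (_ : ∀ y y' : g.Site, 0 ≤ g.dist y y')
      (_ : ∀ y y' : g.Site, g.dist y y' = g.dist y' y) {σr cr : ℝ} (_ : 0 ≤ σr) (_ : RowSum g σr cr)
      (blkΩ : Tor (fine P.L M) → g.Site) {nΩ : ℕ} (_ : ∀ y', (fibre blkΩ y').card ≤ nΩ)
      (blkη : Tor (fine (P.L ^ P.K) (fine P.L M)) → g.Site) {nη : ℕ} (_ : ∀ y', (fibre blkη y').card ≤ nη)
      (pr : Tor (fine (P.L ^ n * P.L ^ P.K) (fine P.L M)) → Tor (fine (P.L ^ P.K) (fine P.L M)))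
      (_ : ∀ x' μ, (pr x' μ).val = (x' μ).val / P.L ^ n)
      -- King's actual operators, read off as linear maps
      (H : (Tor (fine P.L M) → ℝ) →ₗ[ℝ] (Tor (fine (P.L ^ P.K) (fine P.L M)) → ℝ))
      (_ : ∀ φ, H φ = minimiser (P.L ^ P.K) (fine P.L M) (aK a P.L P.K) (((P.L ^ P.K : ℕ) : ℝ) ^ 2) m2 φ)
      (H' : (Tor (fine P.L M) → ℝ) →ₗ[ℝ] (Tor (fine (P.L ^ n * P.L ^ P.K) (fine P.L M)) → ℝ))
      (_ : ∀ φ, H' φ = minimiser (P.L ^ n * P.L ^ P.K) (fine P.L M) (aK a P.L (P.K + n))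
        (((P.L ^ n * P.L ^ P.K : ℕ) : ℝ) ^ 2) m2 φ)
      {w : ℝ} (_ : 0 ≤ w) (K : (Tor (fine (P.L ^ P.K) (fine P.L M)) → ℝ) →ₗ[ℝ] (Tor (fine P.L M) → ℝ))
      (_ : ∀ x b, K (Pi.single x 1) b = w * H (Pi.single b 1) x)
      (K' : (Tor (fine (P.L ^ n * P.L ^ P.K) (fine P.L M)) → ℝ) →ₗ[ℝ] (Tor (fine P.L M) → ℝ))
      (_ : ∀ x' b, K' (Pi.single x' 1) b = w / ((P.L : ℝ) ^ n) ^ P.d * H' (Pi.single b 1) x')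
      -- the two SLACK-FREE unit-torus dominances (the consumer's reading of its site assignments)
      {δC : ℝ} (_ : ∀ x z, δC * g.dist (blkΩ x) (blkΩ z) ≤ delta45 P.d a P.L * tdistT (fine P.L M) x z)
      {κ : ℝ} (_ : 0 < κ)
      (_ : ∀ (bt : Tor (fine P.L M)) (xt : Tor (fine (P.L ^ P.K) (fine P.L M))),
        κ * g.dist (blkΩ bt) (blkη xt) ≤ tdistT (fine P.L M) bt (blockOf (P.L ^ P.K) (fine P.L M) xt))
      -- the rate window
      {ρ : ℝ} (_ : 0 ≤ ρ) (_ : ρ + σr ≤ δ₀ * κ / 2) (_ : ρ + σr ≤ δC),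
      HasMaj (BlockNorm.ofBlocks g blkη) (BlockNorm.ofBlocks g (blkη ∘ pr))
        (idef (pull pr) (pull pr)
          (H' ∘ₗ (Matrix.mulVecLin (effLaplacian (P.L ^ n * P.L ^ P.K) (fine P.L M) (aK a P.L (P.K + n))
              (((P.L ^ n * P.L ^ P.K : ℕ) : ℝ) ^ 2) m2 + (a * ((P.L : ℝ) ^ 2)⁻¹) • blockProj P.L M)⁻¹ ∘ₗ K'))
          (H ∘ₗ (Matrix.mulVecLin (effLaplacian (P.L ^ P.K) (fine P.L M) (aK a P.L P.K) (((P.L ^ P.K : ℕ) : ℝ) ^ 2) m2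
              + (a * ((P.L : ℝ) ^ 2)⁻¹) • blockProj P.L M)⁻¹ ∘ₗ K)))
        (fun y y' =>
          (nΩ * (a * c₀) * cr *
              (nΩ * (2 / gam0L P.d a P.L) * cr *
                  (nη * w * Real.sqrt ((prop38RateConst a a (lemma43Const a P.L P.K n) ((Real.pi ^ 2 / 4) ^ P.d) P.d γ
                    + prop38PosConst a ((Real.pi ^ 2 / 4) ^ P.d) P.d γ) * ((P.L ^ P.K : ℕ) : ℝ) ^ (-γ) * (2 * (a * c₀))))
                + nΩ * (K45 P.d a P.L * ((P.L : ℝ) ^ P.K)⁻¹) * cr * (nη * w * (a * c₀)))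
            + nΩ * Real.sqrt ((prop38RateConst a a (lemma43Const a P.L P.K n) ((Real.pi ^ 2 / 4) ^ P.d) P.d γ
                  + prop38PosConst a ((Real.pi ^ 2 / 4) ^ P.d) P.d γ) * ((P.L ^ P.K : ℕ) : ℝ) ^ (-γ) * (2 * (a * c₀))) * cr *
              (nΩ * (2 / gam0L P.d a P.L) * cr * (nη * w * (a * c₀)))) *
          Real.exp (-(ρ * g.dist y y'))) := by
  obtain ⟨δ₀, c₀, hδ₀, hc₀, H⟩ := minimiser_decay_of_blockDominance dd L hd hL ha hm
  refine ⟨δ₀, c₀, hδ₀, hc₀, ?_⟩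
  intro P hPd hPL hPK _ n hn M _ hMK g _ htri hdist hsymm σr cr hσr hrow blkΩ nΩ hnΩ blkη nη hnη pr hpr Hk hH Hk' hH'
    w hw0 K hK K' hK' δC hdom κ hκ hdomU ρ hρ hρ₁ hρ₂
  have hPd0 : 0 < P.d := by have := P.hd; omega
  have hPodd : Odd P.L := P.hL.1
  have hPL2 : 2 ≤ P.L := by have := P.hL.2; omega
  obtain ⟨hdecA, hdecB⟩ := H P hPd hPL hPK n (fine P.L M) hMK blkΩ blkη pr hpr hdist hκ hdomU
  exact hasMaj_idef_kingPiece_covFree hPd0 hPodd hPL2 hPK hn M ha hm hγ0 hγ1 htri hdist hsymm hσr hrow blkΩ hnΩ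
    blkη hnη pr hpr Hk hH Hk' hH' hw0 K hK K' hK' (c₀ := a * c₀) (δ₀ := δ₀ * κ) (mul_nonneg ha.le hc₀.le)
    (fun b x => by rw [hH]; exact hdecA b x) (fun b x' => by rw [hH']; exact hdecB hn b x') hρ hdom hρ₁ hρ₂

end PieceSlack

end Summit.QuantumFields.YangMills.BalabanUVNodes.N15.DefectKernel
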